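import Summits.KontsevichZagierPeriods.KontsevichZagierPeriods.Theses.PeriodConductors
import Literature.Algebra.EuclideanLattices.EllipseResidueClassCounting
import Summits.KontsevichZagierPeriods.KontsevichZagierPeriods.Theorems.ComplexOrientationsComplexOrientationIdentityEllipse

/-!
# `ConicCalibration` (stmt-KontsevichZagierPeriods-8410, route PeriodConductors) — proof

Statement: for integers `a, b, c` with `0 < a` and `b² < 4ac` (a positive definite integral binary
form), if the area of the open ellipse `{a x₀² + b x₀x₁ + c x₁² < 1} ⊆ ℝ²` is a rational multiple
`q·π` of `π`, then `b` is even.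

Proof. The area is `2π/√D`, `D = 4ac − b²`: the closed ellipse `{Q ≤ 1}` has that area by the
tree's `Literature.Algebra.EuclideanLattices.volume_binQF_le_one` (the linear change of variables
`(√a x₀ + b x₁/(2√a), √D x₁/(2√a))` to the unit disc, determinant `√D/2`), and the boundary conic
`{Q = 1}` is Lebesgue-null (`ComplexOrientations.volume_setOf_binQF_eq`). Comparing with `q·π`
(both inside `ENNReal.ofReal`, the left side positive) gives `2/√D = q`, so `√D = 2/q` is rational
and the positive integer `D` is a perfect square `m²` (`irrational_sqrt_intCast_iff_of_nonneg`).
Finally `b² + m² = 4ac ≡ 0 (mod 4)` forces `b` even, since an odd square is `1 (mod 4)` and every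
square is `0` or `1 (mod 4)`. Reference: M. Kontsevich, D. Zagier, *Periods* (2001), §1.1.
-/

namespace Summit.KontsevichZagierPeriods.PeriodConductors

open MeasureTheory

/-- Area of the open ellipse of a positive definite real binary form:
`vol {A x₀² + B x₀x₁ + C x₁² < 1} = 2π/√(4AC − B²)` (the closed ellipse, of that area, minus its
Lebesgue-null boundary conic). [folklore] -/
theorem volume_setOf_binQF_lt_one {A B C : ℝ} (hA : 0 < A) (hD : 0 < 4 * A * C - B ^ 2) :
    volume {x : Fin 2 → ℝ | A * x 0 ^ 2 + B * x 0 * x 1 + C * x 1 ^ 2 < 1} =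
      ENNReal.ofReal (2 * Real.pi / Real.sqrt (4 * A * C - B ^ 2)) := by
  have hQ : ∀ x : Fin 2 → ℝ, (fun y : Fin 2 → ℝ => A * y 0 ^ 2 + B * y 0 * y 1 + C * y 1 ^ 2) x =
      A * x 0 ^ 2 + B * (x 0 * x 1) + C * x 1 ^ 2 := fun x => by
    simp only [mul_assoc]
  have hle := Literature.Algebra.EuclideanLattices.volume_binQF_le_one hQ hA hD
  have heq := Summit.KontsevichZagierPeriods.ComplexOrientations.volume_setOf_binQF_eq hQ hA hD 1
  have hset : {x : Fin 2 → ℝ | A * x 0 ^ 2 + B * x 0 * x 1 + C * x 1 ^ 2 < 1} =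
      {x : Fin 2 → ℝ | (fun y : Fin 2 → ℝ => A * y 0 ^ 2 + B * y 0 * y 1 + C * y 1 ^ 2) x ≤ 1} \
        {x : Fin 2 → ℝ | (fun y : Fin 2 → ℝ => A * y 0 ^ 2 + B * y 0 * y 1 + C * y 1 ^ 2) x = 1} := by
    ext x
    simp only [Set.mem_setOf_eq, Set.mem_sdiff]
    exact lt_iff_le_and_ne
  rw [hset, measure_sdiff_null heq, hle]

/-- A nonnegative integer whose real square root is rational is a perfect square. [folklore] -/
theorem isSquare_of_sqrt_intCast_eq_ratCast {D : ℤ} (hD : 0 ≤ D) {r : ℚ}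
    (h : Real.sqrt (D : ℝ) = (r : ℝ)) : IsSquare D := by
  by_contra hns
  exact (irrational_sqrt_intCast_iff_of_nonneg hD).2 hns ⟨r, h.symm⟩

/-- Squares modulo `4`: if `4ac − b² = m²` in `ℤ` then `b` is even (an odd square is `1 (mod 4)`,
every square is `0` or `1 (mod 4)`). [folklore] -/
theorem even_of_four_mul_sub_sq_eq_mul_self {a b c m : ℤ} (h : 4 * a * c - b ^ 2 = m * m) :
    Even b := by
  by_contra hb
  rw [Int.not_even_iff_odd] at hb
  obtain ⟨k, rfl⟩ := hb
  rcases Int.even_or_odd m with ⟨j, rfl⟩ | ⟨j, rfl⟩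
  · have h' : 4 * (a * c) = 4 * (k ^ 2 + k + j ^ 2) + 1 := by linear_combination h
    omega
  · have h' : 4 * (a * c) = 4 * (k ^ 2 + k + j ^ 2 + j) + 2 := by linear_combination h
    omega

/-- **`ConicCalibration`** (route PeriodConductors, stmt-KontsevichZagierPeriods-8410): for integers
`a, b, c` with `0 < a`, `b² < 4ac`, if the area of the ellipse `{a x₀² + b x₀x₁ + c x₁² < 1}` is a
rational multiple of `π` then `b` is even. The area is `2π/√(4ac − b²)`
(`volume_setOf_binQF_lt_one`), so `√(4ac − b²) = 2/q ∈ ℚ` makes `4ac − b²` a perfect square `m²`,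
and `b² + m² ≡ 0 (mod 4)` forces `b` even. [cite: KontsevichZagier2001, §1.1] -/
theorem conicCalibration_proof :
    Summit.KontsevichZagierPeriods.KontsevichZagierPeriods.Theses.PeriodConductors.ConicCalibration := by
  intro a b c ha hdisc hq
  obtain ⟨q, hvol⟩ := hq
  have hD : (0 : ℤ) < 4 * a * c - b ^ 2 := sub_pos.mpr hdisc
  have haR : (0 : ℝ) < (a : ℝ) := by exact_mod_cast ha
  have hDR : (0 : ℝ) < 4 * (a : ℝ) * (c : ℝ) - (b : ℝ) ^ 2 := by exact_mod_cast hD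
  rw [volume_setOf_binQF_lt_one haR hDR] at hvol
  have hs0 : 0 < Real.sqrt (4 * (a : ℝ) * (c : ℝ) - (b : ℝ) ^ 2) := Real.sqrt_pos.2 hDR
  have hlhs : 0 < 2 * Real.pi / Real.sqrt (4 * (a : ℝ) * (c : ℝ) - (b : ℝ) ^ 2) := by positivity
  -- the right-hand side `q·π` is positive, else its `ofReal` vanishes while the area does not
  have hqπ : 0 < (q : ℝ) * Real.pi := by
    by_contra hle
    rw [not_lt] at hle
    rw [ENNReal.ofReal_of_nonpos hle, ENNReal.ofReal_eq_zero] at hvol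
    exact absurd hvol (not_le.2 hlhs)
  have hqne : (q : ℝ) ≠ 0 := by
    intro h0
    rw [h0, zero_mul] at hqπ
    exact lt_irrefl _ hqπ
  rw [ENNReal.ofReal_eq_ofReal_iff hlhs.le hqπ.le, div_eq_iff hs0.ne'] at hvol
  -- `hvol : 2π = qπ·√D`, hence `√D = 2/q` is rational
  have hs_eq : Real.sqrt (4 * (a : ℝ) * (c : ℝ) - (b : ℝ) ^ 2) = ((2 / q : ℚ) : ℝ) := by
    push_cast
    rw [eq_div_iff hqne]
    have h2 : Real.pi * (Real.sqrt (4 * (a : ℝ) * (c : ℝ) - (b : ℝ) ^ 2) * q - 2) = 0 := by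
      linear_combination -hvol
    rcases mul_eq_zero.1 h2 with h | h
    · exact absurd h Real.pi_pos.ne'
    · linarith
  have hsq : IsSquare (4 * a * c - b ^ 2) :=
    isSquare_of_sqrt_intCast_eq_ratCast hD.le (r := 2 / q) (by exact_mod_cast hs_eq)
  obtain ⟨m, hm⟩ := hsq
  exact even_of_four_mul_sub_sq_eq_mul_self hm

end Summit.KontsevichZagierPeriods.PeriodConductors
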